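import Summits.BirchSwinnertonDyer.BirchSwinnertonDyer.Theorems.ClassRecordThreeCartanSupplyFrobeniusPairing
import HarnessLib

/-!
# The cubic character tables (FGT-PS) ∧ (FGT-C) PROVED — §F.6–§F.8 of the `doublecoset` certificate for crux 24801 `CartanOnePlaceDegreeLawAtThree`

Lift-only port (cell bsd-stepL, SUMMON key `k5-lift1`, director-bsd (734)(1) CONCUR 2026-08-31) of §F.6–§F.8 (source lines 1306–1641) of the crux-ideate workfile
`Summits/BirchSwinnertonDyer/BirchSwinnertonDyer/Cruxes/CartanOnePlaceDegreeLawAtThree/Lines/doublecoset.lean` (lineage `cruxidea-stmt-BirchSwinnertonDyer-24801-1`, generation 22,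
commit 721e9ccbdf4b, sha256-16 d3adee7328f6a76c, 2876 l.; farm rc 0, sorries 4 = its §4 stubs, none of which is lifted; referee landing record `VERDICT-DOUBLECOSET-G22-g88.md`).
Declarations, statements and proofs below are BYTE-IDENTICAL to the source; the only edits are the namespace (`…Cruxes.CartanOnePlaceDegreeLawAtThree.Doublecoset` ↦
`…Theorems.CartanDoubleCoset`, shared by the nine `ClassRecordThreeCartanSupply*` modules), the imports ∕ `open`s each module needs, and one-line docstrings added where the source
had none. Nothing is re-stated, weakened or re-proved.

CONTENT (finite group theory; generation 20, real proofs). §F.6 (FGT-C) for `q ≥ 5`: the tree's cubic torus character is a cubic torus character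
(`isCubicTorusCharacter_torusChar`); in an irreducible `W` with a `T_η`-fixed vector the scalars act trivially (`scalar_trivial`) and, if `G` moves something, a
Whittaker vector exists (`exists_four_ne_zero`, by the unipotent rigidity of `…UnipotentRigidity`); Frobenius reciprocity against `Ind_{ZN} ψ − Ind_{T_η} θ₃`
(`CartanSupply.Monomial.cuspChar_eq`) pins the type (`cubicCuspidalCharacter_of_five_le`). §F.7 (FGT-C) at `q = 2` (`GL₂(𝔽₂) ≅ S₃`, `T_η = A₃`, `χ = sgn =
χ_{Ind_{T_η} 1} − 1`: `cubicNewvectorChar_two`, `monRep_one_character_two`, `cubicCuspidalCharacter_two`). §F.8 the tables: `cubicCuspidalCharacter :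
CubicCuspidalCharacter` and `cubicCharacterTables : CubicPrincipalSeriesCharacter ∧ CubicCuspidalCharacter`.

HONEST: a `--supports stmt-BirchSwinnertonDyer-24801` helper module; it proves NOTHING about NUM ∕ NUM♮ (items 24801 ∕ 32276) or crux 19109 for any curve — the leaves (MO1)
`SplitLevelMultiplicityOne`, (BCV) `BorelCubicEigenDocking`, (VAN) `NonsplitTorusCubicVanishing`, (DS) ∧ (JLᶜ) stay OPEN; registry `Lines/petarea.lean` rev 8 untouched; BSD is proved for no curve.
-/

set_option linter.dupNamespace false  -- `Summit.BirchSwinnertonDyer.BirchSwinnertonDyer.…` (summit = problem), as every file of this directory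
set_option autoImplicit false

noncomputable section

open scoped Classical MatrixGroups
open Matrix

namespace Summit.BirchSwinnertonDyer.BirchSwinnertonDyer.Theorems.CartanDoubleCoset

open Summit.BirchSwinnertonDyer.BirchSwinnertonDyer.Theorems
open Summit.BirchSwinnertonDyer.BirchSwinnertonDyer.Theorems.CartanDegree (HasRatEigenvalue)
open Summit.BirchSwinnertonDyer.BirchSwinnertonDyer.Theorems.CartanTorusCubeCut (torusSubgroup mem_torusSubgroup lin linGL linGL_coe lin_comm torusSubgroup_isCyclic card_torusSubgroup)
open Summit.BirchSwinnertonDyer.BirchSwinnertonDyer.Theorems.CartanCover (splitGen mem_splitTorus_iff)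
open Summit.BirchSwinnertonDyer.BirchSwinnertonDyer.Theorems.CartanCover.Charext.InertHecke (upperUnip lowerUnip coe_upperUnip coe_lowerUnip upperUnip_mul upperUnip_zero exists_unip_factorization)
open scoped Pointwise ModularForm NumberField
open Module UpperHalfPlane
open Literature.NumberTheory.Automorphic WeierstrassCurve Literature.NumberTheory.EllipticCurves Literature.NumberTheory.EllipticCurves.ModularForms
open Literature.NumberTheory.EllipticCurves.Rank1Residual Summit.BirchSwinnertonDyer.Rank1Residual Literature.NumberTheory.GaloisRepresentations NumberField IsDedekindDomain
open Summit.BirchSwinnertonDyer.BirchSwinnertonDyer.Theorems.CartanCover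
open Summit.BirchSwinnertonDyer.BirchSwinnertonDyer.Theorems.CartanCover.CMRank
open Summit.BirchSwinnertonDyer.BirchSwinnertonDyer.Theorems.CartanTorusCubeCut
open Summit.BirchSwinnertonDyer.BirchSwinnertonDyer.Theorems.CartanDegree (cubicNewvectorChar HasRatEigenvalue)

/-! ### §F.6 (FGT-C) PROVED for `q ≥ 5`: a Whittaker vector and torus-blindness pin the cuspidal representation -/

section Cusp

open Representation (IntertwiningMap)
open Summit.BirchSwinnertonDyer.BirchSwinnertonDyer.Theorems.CartanTorusCubeCut (G Mat)
open Summit.BirchSwinnertonDyer.BirchSwinnertonDyer.Theorems.CartanSupply.Monomial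
open Summit.BirchSwinnertonDyer.BirchSwinnertonDyer.Theorems.CartanCover (Charext.scalarGL Charext.coe_scalarGL Charext.scalarGL_comm
  Charext.scalarGL_mem_torusSubgroup)

variable {q : ℕ} [Fact q.Prime]

/-- the tree's cubic torus character `torusChar`, extended by `1` off `T_η`, is a cubic torus character in the sense of §0. -/
theorem isCubicTorusCharacter_torusChar {ζ : ℂˣ} (hζ : IsPrimitiveRoot ζ 3) {eta : Matrix (Fin 2) (Fin 2) (ZMod q)}
    (hη : ¬ HasRatEigenvalue eta) (hq5 : 5 ≤ q) :
    IsCubicTorusCharacter eta (fun g => if hg : g ∈ torusSubgroup eta then torusChar hζ hη hq5 ⟨g, hg⟩ else 1) := by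
  refine ⟨fun t ht t' ht' => ?_, fun c hc => ?_, ?_⟩
  · beta_reduce
    rw [dif_pos ht, dif_pos ht', dif_pos ((torusSubgroup eta).mul_mem ht ht'), ← map_mul]; rfl
  · beta_reduce
    rw [dif_pos ((torusSubgroup eta).pow_mem hc 3)]
    have e : (⟨c ^ 3, (torusSubgroup eta).pow_mem hc 3⟩ : torusSubgroup eta) = ⟨c, hc⟩ ^ 3 := rfl
    rw [e, map_pow, torusChar_apply]
    exact val_cubicChar_pow_three _ hζ _ _
  · refine ⟨((gen (torusSubgroup_isCyclic hη) : torusSubgroup eta) : GL (Fin 2) (ZMod q)), (gen (torusSubgroup_isCyclic hη)).2, ?_⟩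
    beta_reduce
    rw [dif_pos (gen (torusSubgroup_isCyclic hη)).2]
    show torusChar hζ hη hq5 (gen (torusSubgroup_isCyclic hη)) ≠ 1
    rw [torusChar_apply, show torusCubic hζ hη hq5 (gen (torusSubgroup_isCyclic hη)) = ζ from cubicChar_gen _ hζ _]
    exact fun h => hζ.ne_one (by norm_num) (Units.val_eq_one.1 h)

variable {W : Type} [AddCommGroup W] [Module ℂ W] (ρ : Representation ℂ (GL (Fin 2) (ZMod q)) W)

/-- the `G`-span of a vector is `G`-stable. -/
theorem span_orbit_stable (u : W) :
    ∀ g : GL (Fin 2) (ZMod q), ∀ w ∈ Submodule.span ℂ (Set.range fun g : GL (Fin 2) (ZMod q) => ρ g u),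
      ρ g w ∈ Submodule.span ℂ (Set.range fun g : GL (Fin 2) (ZMod q) => ρ g u) := by
  intro g w hw
  have hle : Submodule.span ℂ (Set.range fun g : GL (Fin 2) (ZMod q) => ρ g u) ≤
      (Submodule.span ℂ (Set.range fun g : GL (Fin 2) (ZMod q) => ρ g u)).comap (ρ g) := by
    refine Submodule.span_le.mpr ?_
    rintro _ ⟨g', rfl⟩
    rw [SetLike.mem_coe, Submodule.mem_comap]
    refine Submodule.subset_span ⟨g * g', ?_⟩
    simp only [map_mul, Module.End.mul_apply]
  exact hle hw

/-- in a `W` with no proper non-zero stable subspace, the `G`-span of a non-zero vector is everything. -/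
theorem span_orbit_eq_top (hirr : ∀ W' : Submodule ℂ W, (∀ g : GL (Fin 2) (ZMod q), ∀ w ∈ W', ρ g w ∈ W') → W' = ⊥ ∨ W' = ⊤)
    {u : W} (hu0 : u ≠ 0) : Submodule.span ℂ (Set.range fun g : GL (Fin 2) (ZMod q) => ρ g u) = ⊤ :=
  (hirr _ (span_orbit_stable ρ u)).resolve_left fun hbot => hu0 (by
    have hu : u ∈ Submodule.span ℂ (Set.range fun g : GL (Fin 2) (ZMod q) => ρ g u) := Submodule.subset_span ⟨1, by simp⟩
    rw [hbot] at hu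
    exact (Submodule.mem_bot ℂ).1 hu)

/-- an operator commuting with `G` up to its action on `u` that fixes every `ρ g u` fixes everything once the span is `⊤`:
concretely, if `ρ s (ρ g u) = ρ g u` for all `g` then `ρ s = 1` on `W`. -/
theorem act_trivial_of_fix_orbit (hirr : ∀ W' : Submodule ℂ W, (∀ g : GL (Fin 2) (ZMod q), ∀ w ∈ W', ρ g w ∈ W') → W' = ⊥ ∨ W' = ⊤)
    {u : W} (hu0 : u ≠ 0) (s : GL (Fin 2) (ZMod q)) (hs : ∀ g : GL (Fin 2) (ZMod q), ρ s (ρ g u) = ρ g u) (w : W) :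
    ρ s w = w := by
  have hle : Submodule.span ℂ (Set.range fun g : GL (Fin 2) (ZMod q) => ρ g u) ≤ LinearMap.eqLocus (ρ s) LinearMap.id := by
    refine Submodule.span_le.mpr ?_
    rintro _ ⟨g, rfl⟩
    rw [SetLike.mem_coe, LinearMap.mem_eqLocus, LinearMap.id_apply]
    exact hs g
  have := hle (show w ∈ _ by rw [span_orbit_eq_top ρ hirr hu0]; trivial)
  rw [LinearMap.mem_eqLocus, LinearMap.id_apply] at this
  exact this

/-- in an irreducible `W` with a `T_η`-fixed vector the scalars act trivially. -/
theorem scalar_trivial {eta : Matrix (Fin 2) (Fin 2) (ZMod q)}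
    (hirr : ∀ W' : Submodule ℂ W, (∀ g : GL (Fin 2) (ZMod q), ∀ w ∈ W', ρ g w ∈ W') → W' = ⊥ ∨ W' = ⊤)
    {u : W} (hu0 : u ≠ 0) (hu : ∀ t ∈ torusSubgroup eta, ρ t u = u) (a : (ZMod q)ˣ) (w : W) :
    ρ (Charext.scalarGL a) w = w := by
  refine act_trivial_of_fix_orbit ρ hirr hu0 _ (fun g => ?_) w
  rw [← Module.End.mul_apply, ← map_mul, ← Charext.scalarGL_comm, map_mul, Module.End.mul_apply,
    hu _ (Charext.scalarGL_mem_torusSubgroup eta a)]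

/-- **a Whittaker vector exists**: in an irreducible `W` with a `T_η`-fixed vector and `G` acting non-trivially some Fourier projector
`Φ_j`, `j ≠ 0`, is non-zero (else `N`, hence `SL₂(𝔽_q)`, acts trivially; `det T_η = 𝔽_q^×` then makes `u` `G`-fixed, so `G` acts trivially). -/
theorem exists_four_ne_zero {eta : Matrix (Fin 2) (Fin 2) (ZMod q)} (hη : ¬ HasRatEigenvalue eta)
    (hirr : ∀ W' : Submodule ℂ W, (∀ g : GL (Fin 2) (ZMod q), ∀ w ∈ W', ρ g w ∈ W') → W' = ⊥ ∨ W' = ⊤)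
    {u : W} (hu0 : u ≠ 0) (hu : ∀ t ∈ torusSubgroup eta, ρ t u = u)
    (hmove : ∃ (g : GL (Fin 2) (ZMod q)) (w : W), ρ g w ≠ w) :
    ∃ (j : ZMod q) (w : W), j ≠ 0 ∧ four ρ j w ≠ 0 := by
  by_contra hcon
  push Not at hcon
  have hq0 : (q : ℂ) ≠ 0 := Nat.cast_ne_zero.2 (Fact.out : q.Prime).ne_zero
  have hN : ∀ (x : ZMod q) (w : W), ρ (upperUnip x) w = w := by
    intro x w
    have hsum : (q : ℂ) • w = four ρ 0 w := by
      rw [← sum_four ρ w, Finset.sum_eq_single (0 : ZMod q) (fun j _ hj => hcon j w hj) (fun h => absurd (Finset.mem_univ _) h)]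
    have h0 : ρ (upperUnip x) (four ρ 0 w) = four ρ 0 w := by
      rw [unip_four, zero_mul, AddChar.map_zero_eq_one, one_smul]
    have h1 : ρ (upperUnip x) ((q : ℂ) • w) = (q : ℂ) • w := by rw [hsum, h0]
    rw [map_smul] at h1
    exact smul_right_injective W hq0 h1
  have hSL : ∀ g : GL (Fin 2) (ZMod q), (g : Matrix (Fin 2) (Fin 2) (ZMod q)).det = 1 → ∀ w : W, ρ g w = w := by
    intro g hg w
    have hG : ∀ g : GL (Fin 2) (ZMod q), ∀ w ∈ (⊤ : Submodule ℂ W), ρ g w ∈ (⊤ : Submodule ℂ W) := fun _ _ _ => trivial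
    have hNf : ∀ x : ZMod q, upperUnip x ∈ fixer ρ ⊤ := fun x => (mem_fixer ρ).2 fun w _ => hN x w
    exact (mem_fixer ρ).1 (mem_fixer_of_det_one ρ hG hNf g hg) w trivial
  have hGu : ∀ g : GL (Fin 2) (ZMod q), ρ g u = u := by
    intro g
    obtain ⟨p, hp0, hpdet⟩ := CartanTransport.ResidueField.exists_lin_det_eq hη (det_coe_ne_zero g)
    have ht'T : linGL eta hη p ∈ torusSubgroup eta := by
      rw [mem_torusSubgroup, linGL_coe hη hp0]; exact lin_comm eta p
    have hdet1 : (((g * (linGL eta hη p)⁻¹ : GL (Fin 2) (ZMod q)) : Matrix (Fin 2) (Fin 2) (ZMod q))).det = 1 := by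
      rw [← Matrix.GeneralLinearGroup.val_det_apply, map_mul, map_inv, Units.val_mul, Matrix.GeneralLinearGroup.val_det_apply,
        Units.val_inv_eq_inv_val, Matrix.GeneralLinearGroup.val_det_apply, linGL_coe hη hp0, hpdet, mul_inv_cancel₀ (det_coe_ne_zero g)]
    calc ρ g u = ρ ((g * (linGL eta hη p)⁻¹) * linGL eta hη p) u := by rw [inv_mul_cancel_right]
      _ = ρ (g * (linGL eta hη p)⁻¹) (ρ (linGL eta hη p) u) := by rw [map_mul, Module.End.mul_apply]
      _ = u := by rw [hu _ ht'T, hSL _ hdet1]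
  obtain ⟨g, w, hgw⟩ := hmove
  exact hgw (act_trivial_of_fix_orbit ρ hirr hu0 g (fun g' => by rw [hGu, hGu]) w)

variable [Module.Finite ℂ W]

/-- **(FGT-C) PROVED for `q ≥ 5`.** -/
theorem cubicCuspidalCharacter_of_five_le (hq3 : q % 3 = 2) (hq5 : 5 ≤ q) (eta : Matrix (Fin 2) (Fin 2) (ZMod q))
    (hη : ¬ HasRatEigenvalue eta)
    (hirr : ∀ W' : Submodule ℂ W, (∀ g : GL (Fin 2) (ZMod q), ∀ w ∈ W', ρ g w ∈ W') → W' = ⊥ ∨ W' = ⊤)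
    (hfix : ∃ u : W, u ≠ 0 ∧ ∀ t ∈ torusSubgroup eta, ρ t u = u)
    (hmove : ∃ (g : GL (Fin 2) (ZMod q)) (w : W), ρ g w ≠ w)
    (hno : ∀ (ν : GL (Fin 2) (ZMod q) → ℂ) (w : W), IsCubicTorusCharacter eta ν →
      (∀ t ∈ torusSubgroup eta, ρ t w = ν t • w) → w = 0) :
    ∀ g : GL (Fin 2) (ZMod q), LinearMap.trace ℂ W (ρ g) = (cubicNewvectorChar q g : ℂ) := by
  have hq2 : q ≠ 2 := by omega
  have hq3' : q ≠ 3 := by omega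
  obtain ⟨u, hu0, hu⟩ := hfix
  obtain ⟨ζ, hζ⟩ := exists_primitiveRoot_three_units
  obtain ⟨U, _, _, _, ρU, hUirr, hχU⟩ := exists_irreducible_cubic hq2 hq3'
  -- the Whittaker vector `w₁ := Φ_j w₀ ≠ 0`: an eigenvector of `ZN` for the non-trivial `ψ := ψq(j ·)`
  obtain ⟨j, w₀, hj, hw₁⟩ := exists_four_ne_zero ρ hη hirr hu0 hu hmove
  have hψ : (ψq (q := q)).mulShift j ≠ 1 := ψq_isPrimitive hj
  have hZN : ∀ h : znSub q, res ρ (znSub q) h (four ρ j w₀) = znChar ((ψq (q := q)).mulShift j) h • four ρ j w₀ := by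
    intro h
    obtain ⟨a, b, hab⟩ := exists_upperGL_of_mem_znSub h.2
    have ha0 : (a : ZMod q) ≠ 0 := a.ne_zero
    have hfac : upperGL a a b = Charext.scalarGL a * upperUnip ((a : ZMod q)⁻¹ * b) := by
      apply Units.ext
      rw [Units.val_mul, upperGL_coe, Charext.coe_scalarGL, coe_upperUnip, Matrix.smul_mul, one_mul, Matrix.smul_of]
      simp only [Matrix.smul_cons, Matrix.smul_empty, smul_eq_mul, mul_one, mul_zero, mul_inv_cancel_left₀ ha0]
    obtain ⟨h00, h01, -, -⟩ := upperGL_entries a a b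
    rw [res_apply, znChar_apply, znWeight_apply, ← hab, h00, h01, hfac, map_mul, Module.End.mul_apply, unip_four, map_smul,
      scalar_trivial ρ hirr hu0 hu, AddChar.mulShift_apply, mul_comm ((a : ZMod q))⁻¹ b]
  have hposZN := finrank_hom_pos (znChar ((ψq (q := q)).mulShift j)) (res ρ (znSub q)) hw₁ hZN
  -- torus-blindness: `Hom_{T_η}(θ₃, Res W) = 0`
  have hT0 : Module.finrank ℂ (IntertwiningMap (lineRep (torusChar hζ hη hq5)) (res ρ (torusSubgroup eta))) = 0 := by
    refine finrank_hom_eq_zero _ _ fun v hv => hno _ v (isCubicTorusCharacter_torusChar hζ hη hq5) fun t ht => ?_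
    rw [dif_pos ht]
    exact hv ⟨t, ht⟩
  -- the pairing `⟨χ_W, χ⟩ = |G| · (dim Hom_{ZN} − dim Hom_{T_η}) = |G| · dim Hom_{ZN} ≠ 0`
  have hpair : ∑ g : G q, ρ.character g * ρU.character g⁻¹ ≠ 0 := by
    have hrw : ∀ g : G q, ρ.character g * ρU.character g⁻¹ =
        ρ.character g * (monRep (znSub q) (znChar ((ψq (q := q)).mulShift j))).character g⁻¹ -
          ρ.character g * (monRep (torusSubgroup eta) (torusChar hζ hη hq5)).character g⁻¹ := by
      intro g; rw [hχU, cuspChar_eq hζ hq2 hq3 hq5 hη hψ, mul_sub]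
    simp_rw [hrw]
    rw [Finset.sum_sub_distrib, frobenius_reciprocity, frobenius_reciprocity, hT0, Nat.cast_zero, mul_zero, sub_zero]
    exact mul_ne_zero (by exact_mod_cast Fintype.card_ne_zero) (by exact_mod_cast hposZN.ne')
  intro g
  rw [← hχU g]
  exact char_eq_of_pairing_ne_zero ρU ρ hUirr hirr hpair g

end Cusp

/-! ### §F.7 (FGT-C) PROVED at `q = 2`: `GL₂(𝔽₂) ≅ S₃`, `T_η = A₃`, `χ = sgn = χ_{Ind_{T_η} 1} − 1` -/

section Two

open Representation (IntertwiningMap)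
open Summit.BirchSwinnertonDyer.BirchSwinnertonDyer.Theorems.CartanTorusCubeCut (G Mat)
open Summit.BirchSwinnertonDyer.BirchSwinnertonDyer.Theorems.CartanDegree (IsScalarMat cubicNewvectorCharMat gl2_two_centraliser
  cubicNewvectorChar_two_one)
open Summit.BirchSwinnertonDyer.BirchSwinnertonDyer.Theorems.CartanSupply.Monomial (monRep wt wt_of_mem wt_of_not_mem card_mul_character)
open Summit.BirchSwinnertonDyer.BirchSwinnertonDyer.Theorems.CartanSupply.VirtualCharacter (sum_char_mul_char_inv)

set_option synthInstance.maxSize 8192 in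
set_option synthInstance.maxHeartbeats 400000 in
/-- off the torus `T_η = A₃` the character of `W_2 = sgn` is `−1`: finite check on entries over `𝔽₂`. -/
theorem cubicNewvectorChar_two_of_not_mem (eta : Matrix (Fin 2) (Fin 2) (ZMod 2)) (hη : ¬ HasRatEigenvalue eta) (g : GL (Fin 2) (ZMod 2))
    (hg : g ∉ torusSubgroup eta) : cubicNewvectorChar 2 g = -1 := by
  set G : Matrix (Fin 2) (Fin 2) (ZMod 2) := (g : Matrix (Fin 2) (Fin 2) (ZMod 2)) with hG
  have hdet : G.det ≠ 0 := by
    rw [hG, ← Matrix.GeneralLinearGroup.val_det_apply]; exact Units.ne_zero _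
  have hcomm : ¬ (G 0 0 * eta 0 0 + G 0 1 * eta 1 0 = eta 0 0 * G 0 0 + eta 0 1 * G 1 0 ∧
      G 0 0 * eta 0 1 + G 0 1 * eta 1 1 = eta 0 0 * G 0 1 + eta 0 1 * G 1 1 ∧
      G 1 0 * eta 0 0 + G 1 1 * eta 1 0 = eta 1 0 * G 0 0 + eta 1 1 * G 1 0 ∧
      G 1 0 * eta 0 1 + G 1 1 * eta 1 1 = eta 1 0 * G 0 1 + eta 1 1 * G 1 1) := by
    rintro ⟨e00, e01, e10, e11⟩
    apply hg
    rw [mem_torusSubgroup, ← hG]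
    ext i j
    fin_cases i <;> fin_cases j
    · simpa [Matrix.mul_apply, Fin.sum_univ_two] using e00
    · simpa [Matrix.mul_apply, Fin.sum_univ_two] using e01
    · simpa [Matrix.mul_apply, Fin.sum_univ_two] using e10
    · simpa [Matrix.mul_apply, Fin.sum_univ_two] using e11
  have key : ∀ (a b c d e f i h : ZMod 2), (¬ ∃ x : ZMod 2, x * x + (e * h - f * i) = (e + h) * x) → a * d - b * c ≠ 0 →
      ¬ (a * e + b * i = e * a + f * c ∧ a * f + b * h = e * b + f * d ∧ c * e + d * i = i * a + h * c ∧
          c * f + d * h = i * b + h * d) →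
      ((a + d) ^ 2 - 4 * (a * d - b * c) = 0 ∧ ¬ (b = 0 ∧ c = 0 ∧ a = d)) := by
    decide
  have hη' : ¬ ∃ x : ZMod 2, x * x + (eta 0 0 * eta 1 1 - eta 0 1 * eta 1 0) = (eta 0 0 + eta 1 1) * x := by
    simpa [HasRatEigenvalue, Matrix.det_fin_two, Matrix.trace_fin_two] using hη
  have hdet' : G 0 0 * G 1 1 - G 0 1 * G 1 0 ≠ 0 := by simpa [Matrix.det_fin_two] using hdet
  obtain ⟨hΔ, hsc⟩ := key (G 0 0) (G 0 1) (G 1 0) (G 1 1) (eta 0 0) (eta 0 1) (eta 1 0) (eta 1 1) hη' hdet' hcomm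
  have hΔ' : G.trace ^ 2 - 4 * G.det = 0 := by simpa [Matrix.det_fin_two, Matrix.trace_fin_two] using hΔ
  have hsc' : ¬ IsScalarMat G := hsc
  have h23 : ¬ (2 % 3 = 1) := by decide
  simp only [cubicNewvectorChar, cubicNewvectorCharMat, ← hG, h23, if_false, hΔ', hsc', if_true]

/-- `χ_{W_2} = sgn`: `1` on `T_η = A₃`, `−1` off it. -/
theorem cubicNewvectorChar_two (eta : Matrix (Fin 2) (Fin 2) (ZMod 2)) (hη : ¬ HasRatEigenvalue eta) (g : GL (Fin 2) (ZMod 2)) :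
    (cubicNewvectorChar 2 g : ℂ) = if g ∈ torusSubgroup eta then 1 else -1 := by
  by_cases hg : g ∈ torusSubgroup eta
  · rw [if_pos hg]
    rcases gl2_two_centraliser eta hη g (by rwa [mem_torusSubgroup] at hg) with h1 | h1
    · rw [h1, cubicNewvectorChar_two_one]; norm_num
    · rw [h1]; norm_num
  · rw [if_neg hg, cubicNewvectorChar_two_of_not_mem eta hη g hg]; norm_num

/-- `T_η ⊴ GL₂(𝔽₂)` (index `6 ∕ 3 = 2`). -/
theorem torusSubgroup_two_normal (eta : Matrix (Fin 2) (Fin 2) (ZMod 2)) (hη : ¬ HasRatEigenvalue eta) : (torusSubgroup eta).Normal := by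
  apply Subgroup.normal_of_index_eq_two
  have h1 : (torusSubgroup eta).index * Nat.card (torusSubgroup eta) = Nat.card (GL (Fin 2) (ZMod 2)) := Subgroup.index_mul_card _
  have hc : Nat.card (torusSubgroup eta) = 3 := by rw [Nat.card_eq_fintype_card, card_torusSubgroup hη]
  have hG : Nat.card (GL (Fin 2) (ZMod 2)) = 6 := by
    rw [show (6 : ℕ) = (2 ^ 2 - 1) * (2 ^ 2 - 2) by norm_num]; exact CartanSupply.card_G (q := 2)
  rw [hc, hG] at h1
  omega

/-- the character of `Ind_{T_η}^{GL₂(𝔽₂)} 1`: `2` on `T_η`, `0` off it. -/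
theorem monRep_one_character_two (eta : Matrix (Fin 2) (Fin 2) (ZMod 2)) (hη : ¬ HasRatEigenvalue eta) (g : GL (Fin 2) (ZMod 2)) :
    (monRep (torusSubgroup eta) (1 : torusSubgroup eta →* ℂ)).character g = if g ∈ torusSubgroup eta then 2 else 0 := by
  have hN := torusSubgroup_two_normal eta hη
  have hT : (Nat.card (torusSubgroup eta) : ℂ) = 3 := by rw [Nat.card_eq_fintype_card, card_torusSubgroup hη]; norm_num
  have hGc : (Fintype.card (GL (Fin 2) (ZMod 2)) : ℂ) = 6 := by
    rw [← Nat.card_eq_fintype_card, show Nat.card (GL (Fin 2) (ZMod 2)) = (2 ^ 2 - 1) * (2 ^ 2 - 2) from CartanSupply.card_G (q := 2)]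
    norm_num
  have h := card_mul_character (torusSubgroup eta) (1 : torusSubgroup eta →* ℂ) g
  have hwt : ∀ x : GL (Fin 2) (ZMod 2), wt (torusSubgroup eta) (1 : torusSubgroup eta →* ℂ) (x⁻¹ * g * x) =
      if g ∈ torusSubgroup eta then 1 else 0 := by
    intro x
    by_cases hg : g ∈ torusSubgroup eta
    · have hm : x⁻¹ * g * x ∈ torusSubgroup eta := by simpa using hN.conj_mem g hg x⁻¹
      rw [if_pos hg, wt_of_mem _ _ hm, MonoidHom.one_apply]
    · rw [if_neg hg, wt_of_not_mem]
      intro h'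
      apply hg
      have e : x * (x⁻¹ * g * x) * x⁻¹ = g := by group
      have := hN.conj_mem _ h' x
      rwa [e] at this
  simp_rw [hwt, Finset.sum_const, Finset.card_univ, nsmul_eq_mul, hGc, hT] at h
  split_ifs at h ⊢
  · linear_combination h / 3
  · linear_combination h / 3

variable {W : Type} [AddCommGroup W] [Module ℂ W] [Module.Finite ℂ W] (ρ : Representation ℂ (GL (Fin 2) (ZMod 2)) W)

/-- **(FGT-C) PROVED at `q = 2`** (the cubic-eigenvector hypothesis is not even needed: `W = sgn` is forced by a `T_η`-fixed vector and
non-triviality). -/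
theorem cubicCuspidalCharacter_two (eta : Matrix (Fin 2) (Fin 2) (ZMod 2)) (hη : ¬ HasRatEigenvalue eta)
    (hirr : ∀ W' : Submodule ℂ W, (∀ g : GL (Fin 2) (ZMod 2), ∀ w ∈ W', ρ g w ∈ W') → W' = ⊥ ∨ W' = ⊤)
    (hfix : ∃ u : W, u ≠ 0 ∧ ∀ t ∈ torusSubgroup eta, ρ t u = u)
    (hmove : ∃ (g : GL (Fin 2) (ZMod 2)) (w : W), ρ g w ≠ w) :
    ∀ g : GL (Fin 2) (ZMod 2), LinearMap.trace ℂ W (ρ g) = (cubicNewvectorChar 2 g : ℂ) := by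
  obtain ⟨u, hu0, hu⟩ := hfix
  have hAB : ∀ g : G 2, (cubicNewvectorChar 2 g : ℂ) =
      (monRep (torusSubgroup eta) (1 : torusSubgroup eta →* ℂ)).character g - (lineRep (1 : GL (Fin 2) (ZMod 2) →* ℂ)).character g := by
    intro g
    rw [cubicNewvectorChar_two eta hη, monRep_one_character_two eta hη, lineRep_character, MonoidHom.one_apply]
    split_ifs <;> norm_num
  have hnorm : ∑ g : G 2, cubicNewvectorChar 2 g ^ 2 = Fintype.card (G 2) := by
    have h1 : ∀ g : G 2, cubicNewvectorChar 2 g ^ 2 = 1 := by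
      intro g
      have h := cubicNewvectorChar_two eta hη g
      split_ifs at h
      · have h' : cubicNewvectorChar 2 g = 1 := by exact_mod_cast h
        rw [h']; norm_num
      · have h' : cubicNewvectorChar 2 g = -1 := by exact_mod_cast h
        rw [h']; norm_num
    simp [h1]
  obtain ⟨U, _, _, _, ρU, hUirr, hχU⟩ :=
    exists_irreducible_of_realisation (monRep (torusSubgroup eta) (1 : torusSubgroup eta →* ℂ)) (lineRep (1 : GL (Fin 2) (ZMod 2) →* ℂ))
      hAB hnorm
  -- `Hom_G(1, W) = 0`: a non-zero fixed vector would span a stable line, hence all of `W`, and `G` would act trivially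
  have hG0 : Module.finrank ℂ (IntertwiningMap (lineRep (1 : GL (Fin 2) (ZMod 2) →* ℂ)) ρ) = 0 := by
    refine finrank_hom_eq_zero (1 : GL (Fin 2) (ZMod 2) →* ℂ) ρ fun v hv => ?_
    simp only [MonoidHom.one_apply, one_smul] at hv
    by_contra hv0
    obtain ⟨g, w, hgw⟩ := hmove
    apply hgw
    have hst : ∀ g' : GL (Fin 2) (ZMod 2), ∀ x ∈ Submodule.span ℂ ({v} : Set W), ρ g' x ∈ Submodule.span ℂ ({v} : Set W) := by
      intro g' x hx
      obtain ⟨c, rfl⟩ := Submodule.mem_span_singleton.1 hx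
      rw [map_smul, hv]
      exact Submodule.mem_span_singleton.2 ⟨c, rfl⟩
    have htop : Submodule.span ℂ ({v} : Set W) = ⊤ := (hirr _ hst).resolve_left fun hbot => hv0 (by
      have hm : v ∈ Submodule.span ℂ ({v} : Set W) := Submodule.mem_span_singleton_self v
      rw [hbot] at hm
      exact (Submodule.mem_bot ℂ).1 hm)
    obtain ⟨c, rfl⟩ := Submodule.mem_span_singleton.1 (show w ∈ Submodule.span ℂ ({v} : Set W) by rw [htop]; trivial)
    rw [map_smul, hv]
  have hpos := finrank_hom_pos (1 : torusSubgroup eta →* ℂ) (res ρ (torusSubgroup eta)) hu0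
    (fun t => by rw [res_apply, MonoidHom.one_apply, one_smul]; exact hu t t.2)
  have hpair : ∑ g : G 2, ρ.character g * ρU.character g⁻¹ ≠ 0 := by
    have hrw : ∀ g : G 2, ρ.character g * ρU.character g⁻¹ =
        ρ.character g * (monRep (torusSubgroup eta) (1 : torusSubgroup eta →* ℂ)).character g⁻¹ -
          ρ.character g * (lineRep (1 : GL (Fin 2) (ZMod 2) →* ℂ)).character g⁻¹ := by
      intro g; rw [hχU, hAB, mul_sub]
    simp_rw [hrw]
    rw [Finset.sum_sub_distrib, frobenius_reciprocity, sum_char_mul_char_inv (lineRep (1 : GL (Fin 2) (ZMod 2) →* ℂ)) ρ, hG0,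
      Nat.cast_zero, mul_zero, sub_zero]
    exact mul_ne_zero (by exact_mod_cast Fintype.card_ne_zero) (by exact_mod_cast hpos.ne')
  intro g
  rw [← hχU g]
  exact char_eq_of_pairing_ne_zero ρU ρ hUirr hirr hpair g

end Two

/-! ### §F.8 THE CHARACTER TABLES, PROVED: `(FGT-PS) ∧ (FGT-C)` -/

/-- **(FGT-C) PROVED.** -/
theorem cubicCuspidalCharacter : CubicCuspidalCharacter := by
  intro q _ hq3 eta hη W _ _ _ ρ hirr hfix hmove hno
  by_cases hq2 : q = 2
  · subst hq2
    exact cubicCuspidalCharacter_two ρ eta hη hirr hfix hmove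
  · have hq5 : 5 ≤ q := by have := (Fact.out : q.Prime).two_le; omega
    exact cubicCuspidalCharacter_of_five_le ρ hq3 hq5 eta hη hirr hfix hmove hno

/-- **(FGT) THE CUBIC CHARACTER TABLES — PROVED** (generation 19's `stub_cubicCharacterTables`, discharged). -/
theorem cubicCharacterTables : CubicPrincipalSeriesCharacter ∧ CubicCuspidalCharacter :=
  ⟨cubicPrincipalSeriesCharacter, cubicCuspidalCharacter⟩

end Summit.BirchSwinnertonDyer.BirchSwinnertonDyer.Theorems.CartanDoubleCoset

end
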